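import Summits.NavierStokesRegularity.NavierStokesRegularity.Theorems.NoOverheating.Negative.TorsionWindowsExcluded
import Summits.NavierStokesRegularity.NavierStokesRegularity.Theorems.NoOverheating.Negative.SlowScrewWindowsExcluded
import Summits.NavierStokesRegularity.NavierStokesRegularity.Theorems.NoOverheating.Negative.PowerScrewWindowsExcluded

/-!
# KJ-39 — MIXED strata: K2 cannot be met window-by-window inside the excluded strata, even when
# the stratum (and the power `q ≤ Q`) varies from rung to rung

Refuter lineage, Negative lane of crux K2 `NoOverheating` (supports, does not decide).  The sector
kills KJ-32…KJ-36 and the census `excludedStrata_windowSequences` (KJ-38) are SEQUENCE-level: all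
windows of the sequence in ONE stratum with ONE power `q`.  The planner's clauses are
WINDOW-level ("a K2 met by window profiles whose DSS-isometry …").  This file closes the gap by a
pigeonhole: if every window of an admissible sequence lies in SOME stratum — (S1) axisymmetric
profile, (S2') `R^q = 1` with `cmax^q < κ`, (S3') `R^q` a slow screw `g R_θ g⁻¹`,
`|θ| ≤ 2 α₁ · q log c`, with `cmax^q < c₁`, (S4') `R` a fast screw with the Pineau–Vicol (ii)
bounds at fixed `Θ`, `ℓ < log c₂` — the stratum and the power `q ≤ Q` depending on the window —
then one stratum (with one `q`) recurs infinitely often (`Filter.extraction_of_frequently_atTop`,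
finitely many classes), the corresponding subsequence is again admissible, and the sequence-level
theorem kills it.
* `no_windowSequence_mixedStrata` — window-sequence form (§1);
* `not_cofinal_and_noOverheating_mixedStrata` — the reading on K1 ∧ K2 (§2): for every `C₀`,
  `Q`, `Θ` and `ℓ < log c₂(C₀)`, `RungBlowupCofinal` together with a `NoOverheating` (constant
  `C₀`) each of whose windows lies in (S1) ∨ (S2') ∨ (S3') ∨ (S4') is contradictory;
* `rungBlowupCofinal_false_of_noOverheating_mixedStrata` — census edge on K1.
(S0) `C₀ ≤ ε₀` is constant-level and stays with `not_cofinal_and_noOverheating_smallConstant`.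
WHAT THIS IS NOT: not `¬NoOverheating` (vacuous without K1 instances), no new Literature fact, no
definition; standard axioms only.
[cite: KochNadirashviliSereginSverak2009, Theorems 1.2–1.3]
[cite: ChaeWolf2017RemovingDSS, Theorem 1.3 (arXiv:1610.09464 p. 3)]
[cite: PineauVicol2026, Theorem 1.7 (i)–(ii) (arXiv:2607.09619 p. 7)] -/

namespace Summit.NavierStokesRegularity.AngularGalerkinLadderMixedStrataExcluded

open Set Filter MeasureTheory Topology Function
open Literature.Analysis Literature.Analysis.FluidPDE
open Summit.NavierStokesRegularity.FluidComputer
open Summit.NavierStokesRegularity.NavierStokesRegularity.Theses.AngularGalerkinLadder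
open Summit.NavierStokesRegularity.AngularGalerkinLadderAxisymmetricWindowsExcluded
open Summit.NavierStokesRegularity.AngularGalerkinLadderFineRatioWindowsExcluded
open Summit.NavierStokesRegularity.AngularGalerkinLadderTorsionWindowsExcluded
open Summit.NavierStokesRegularity.AngularGalerkinLadderSlowScrewWindowsExcluded
open Summit.NavierStokesRegularity.AngularGalerkinLadderPowerScrewWindowsExcluded

/-! ### §1 Window sequences with mixed strata -/

/-- **No admissible window sequence each of whose windows lies in SOME excluded stratum.**  For
every `C₀` there are `κ > 1` (Chae–Wolf), `α₁ > 0`, `c₁ > 1` (Pineau–Vicol (i)), `α₂ > 0`, `c₂ > 1`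
(Pineau–Vicol (ii)) such that for every bound `Q` on the powers and every `Θ`, `ℓ < log c₂`: an
admissible window sequence (`1 < cmin`, `0 < δ`, `εₙ → 0`, window rung profiles with constant
`C₀`) whose `n`-th window is, for each `n`, axisymmetric (S1), or of finite order `Rₙ^q = 1`,
`q ≤ Q`, `cmax^q < κ` (S2'), or has `Rₙ^q` (`q ≤ Q`, `cmax^q < c₁`) a slow screw about some axis
(S3'), or has
`Rₙ` a fast screw with the (ii)-bounds (S4'), is contradictory — pigeonhole over the finitely many
classes, extraction of an admissible subsequence in one class, and the sequence-level theorems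
`no_axisymmetric_windowSequence`, `no_windowSequence_finiteOrder_fineRatio`,
`no_windowSequence_powSlowScrew`, `no_windowSequence_fastScrew`.
[cite: ChaeWolf2017RemovingDSS, Theorem 1.3] [cite: PineauVicol2026, Theorem 1.7 (i)–(ii)] -/
theorem no_windowSequence_mixedStrata (C₀ : ℝ) :
    ∃ κ α₁ c₁ α₂ c₂ : ℝ, 1 < κ ∧ 0 < α₁ ∧ 1 < c₁ ∧ 0 < α₂ ∧ 1 < c₂ ∧
      ∀ (Q : ℕ) (Θ ℓ : ℝ) {cmin cmax δ : ℝ} {L : ℕ → ℕ} {ε c : ℕ → ℝ}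
        {R : ℕ → (EuclideanSpace ℝ (Fin 3) ≃ₗᵢ[ℝ] EuclideanSpace ℝ (Fin 3))}
        {u : ℕ → ℝ → EuclideanSpace ℝ (Fin 3) → EuclideanSpace ℝ (Fin 3)}
        {p : ℕ → ℝ → EuclideanSpace ℝ (Fin 3) → ℝ}
        {d : ℕ → ℝ → EuclideanSpace ℝ (Fin 3) → EuclideanSpace ℝ (Fin 3)},
        ℓ < Real.log c₂ → 1 < cmin → 0 < δ → Tendsto ε atTop (𝓝 0) →
        (∀ n, AngularLadder.IsWindowProfile (L n) C₀ cmin cmax δ (ε n) (c n) (R n) (u n) (p n)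
          (d n)) →
        (∀ n, (∀ t < 0, IsAxisymmetric (u n t)) ∨
          (∃ q : ℕ, 0 < q ∧ q ≤ Q ∧ cmax ^ q < κ ∧ (R n) ^ q = 1) ∨
          (∃ (q : ℕ) (g : EuclideanSpace ℝ (Fin 3) ≃ₗᵢ[ℝ] EuclideanSpace ℝ (Fin 3)) (θ : ℝ),
            0 < q ∧ q ≤ Q ∧ cmax ^ q < c₁ ∧ (∀ x, ((R n) ^ q) x = g (rotZ θ (g.symm x))) ∧
            |θ| ≤ 2 * α₁ * (q * Real.log (c n))) ∨
          (∃ (g : EuclideanSpace ℝ (Fin 3) ≃ₗᵢ[ℝ] EuclideanSpace ℝ (Fin 3)) (θ : ℝ),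
            (∀ x, R n x = g (rotZ θ (g.symm x))) ∧ |θ| ≤ Θ ∧ 2 * α₂ * Real.log (c n) ≤ |θ| ∧
            (1 + (θ / (2 * Real.log (c n))) ^ 2) * Real.log (c n) ≤ ℓ)) →
        False := by
  obtain ⟨κ, hκ, H2⟩ := no_windowSequence_finiteOrder_fineRatio C₀
  obtain ⟨α₁, hα₁, c₁, hc₁, H3⟩ := no_windowSequence_powSlowScrew C₀
  obtain ⟨α₂, hα₂, c₂, hc₂, H4⟩ := no_windowSequence_fastScrew C₀
  refine ⟨κ, α₁, c₁, α₂, c₂, hκ, hα₁, hc₁, hα₂, hc₂, ?_⟩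
  intro Q Θ ℓ cmin cmax δ L ε c R u p d hℓ hcmin hδ hε hW hS
  have hsub : ∀ φ : ℕ → ℕ, StrictMono φ → Tendsto (fun n => ε (φ n)) atTop (𝓝 0) :=
    fun φ hφ => hε.comp hφ.tendsto_atTop
  -- (S1) infinitely often: an axisymmetric admissible subsequence (KNSS).
  by_cases h1 : ∃ᶠ n in atTop, ∀ t < 0, IsAxisymmetric (u n t)
  · obtain ⟨φ, hφ, hφ1⟩ := extraction_of_frequently_atTop h1
    exact no_axisymmetric_windowSequence ⟨C₀, cmin, cmax, δ, fun n => L (φ n),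
      fun n => ε (φ n), fun n => c (φ n), fun n => R (φ n), fun n => u (φ n), fun n => p (φ n),
      fun n => d (φ n),
      hcmin, hδ, hsub φ hφ, fun n => hW (φ n), fun n => hφ1 n⟩
  -- (S2') infinitely often with one `q ≤ Q`: a finite-order admissible subsequence (Chae–Wolf).
  by_cases h2 : ∃ q ∈ Finset.range (Q + 1), ∃ᶠ n in atTop, 0 < q ∧ cmax ^ q < κ ∧ (R n) ^ q = 1
  · obtain ⟨q, -, hq⟩ := h2
    obtain ⟨φ, hφ, hφ2⟩ := extraction_of_frequently_atTop hq
    exact H2 (hφ2 0).1 (hφ2 0).2.1 hcmin hδ (hsub φ hφ) (fun n => hW (φ n))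
      fun n => (hφ2 n).2.2
  -- (S3') infinitely often with one `q ≤ Q`: slow screws up to the power `q` (Pineau–Vicol (i)).
  by_cases h3 : ∃ q ∈ Finset.range (Q + 1), ∃ᶠ n in atTop,
      ∃ (g : EuclideanSpace ℝ (Fin 3) ≃ₗᵢ[ℝ] EuclideanSpace ℝ (Fin 3)) (θ : ℝ), 0 < q ∧
        cmax ^ q < c₁ ∧ (∀ x, ((R n) ^ q) x = g (rotZ θ (g.symm x))) ∧
        |θ| ≤ 2 * α₁ * (q * Real.log (c n))
  · obtain ⟨q, -, hq⟩ := h3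
    obtain ⟨φ, hφ, hφ3⟩ := extraction_of_frequently_atTop hq
    choose g θ hq0 hcq hconj hθ using hφ3
    exact H3 (hq0 0) (hcq 0) hcmin hδ (hsub φ hφ) (fun n => hW (φ n)) (fun n x => hconj n x) hθ
  -- (S4') infinitely often: fast screws (Pineau–Vicol (ii)).
  by_cases h4 : ∃ᶠ n in atTop,
      ∃ (g : EuclideanSpace ℝ (Fin 3) ≃ₗᵢ[ℝ] EuclideanSpace ℝ (Fin 3)) (θ : ℝ),
      (∀ x, R n x = g (rotZ θ (g.symm x))) ∧ |θ| ≤ Θ ∧ 2 * α₂ * Real.log (c n) ≤ |θ| ∧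
        (1 + (θ / (2 * Real.log (c n))) ^ 2) * Real.log (c n) ≤ ℓ
  · obtain ⟨φ, hφ, hφ4⟩ := extraction_of_frequently_atTop h4
    choose g θ hconj hΘ hlow hquad using hφ4
    exact H4 hℓ hcmin hδ (hsub φ hφ) (fun n => hW (φ n)) (fun n x => hconj n x) hΘ hlow hquad
  -- Otherwise, eventually no stratum is available: contradiction with `hS`.
  have h1' := not_frequently.1 h1
  have h2' : ∀ᶠ n in atTop, ∀ q ∈ Finset.range (Q + 1),
      ¬ (0 < q ∧ cmax ^ q < κ ∧ (R n) ^ q = 1) :=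
    (eventually_all_finset _).2 fun q hq => not_frequently.1 fun hf => h2 ⟨q, hq, hf⟩
  have h3' : ∀ᶠ n in atTop, ∀ q ∈ Finset.range (Q + 1),
      ¬ ∃ (g : EuclideanSpace ℝ (Fin 3) ≃ₗᵢ[ℝ] EuclideanSpace ℝ (Fin 3)) (θ : ℝ), 0 < q ∧
        cmax ^ q < c₁ ∧ (∀ x, ((R n) ^ q) x = g (rotZ θ (g.symm x))) ∧
        |θ| ≤ 2 * α₁ * (q * Real.log (c n)) :=
    (eventually_all_finset _).2 fun q hq => not_frequently.1 fun hf => h3 ⟨q, hq, hf⟩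
  have h4' := not_frequently.1 h4
  obtain ⟨n, hn1, hn2, hn3, hn4⟩ := (h1'.and (h2'.and (h3'.and h4'))).exists
  rcases hS n with hs | ⟨q, hq0, hqQ, hcq, hRq⟩ | ⟨q, g, θ, hq0, hqQ, hcq, hconj, hθ⟩ |
    ⟨g, θ, hconj, hΘ, hlow, hquad⟩
  · exact hn1 hs
  · exact hn2 q (Finset.mem_range.2 (Nat.lt_succ_of_le hqQ)) ⟨hq0, hcq, hRq⟩
  · exact hn3 q (Finset.mem_range.2 (Nat.lt_succ_of_le hqQ)) ⟨g, θ, hq0, hcq, hconj, hθ⟩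
  · exact hn4 ⟨g, θ, hconj, hΘ, hlow, hquad⟩

/-! ### §2 The reading on K1 ∧ K2 -/

/-- **K1 ∧ (K2 met window-by-window inside the excluded strata, mixing allowed) is FALSE.**  For
every `C₀` there are `κ > 1`, `α₁ > 0`, `c₁ > 1`, `α₂ > 0`, `c₂ > 1` such that for every `Q`, `Θ`
and `ℓ < log c₂`: `RungBlowupCofinal` together with constants `1 < cmin`, `0 < δ`, `ε_L → 0`, `L₀`
and, on every singular rung `L ≥ L₀`, a window rung profile with constant `C₀` lying in (S1) or
(S2') or (S3') or (S4') (stratum and power `q ≤ Q` may depend on the rung) is contradictory.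
[cite: ChaeWolf2017RemovingDSS, Theorem 1.3] [cite: PineauVicol2026, Theorem 1.7 (i)–(ii)] -/
theorem not_cofinal_and_noOverheating_mixedStrata (C₀ : ℝ) :
    ∃ κ α₁ c₁ α₂ c₂ : ℝ, 1 < κ ∧ 0 < α₁ ∧ 1 < c₁ ∧ 0 < α₂ ∧ 1 < c₂ ∧
      ∀ (Q : ℕ) (Θ ℓ : ℝ), ℓ < Real.log c₂ →
      ¬ (RungBlowupCofinal ∧
        ∃ (cmin cmax δ : ℝ) (L₀ : ℕ) (ε : ℕ → ℝ), 1 < cmin ∧ 0 < δ ∧ Tendsto ε atTop (𝓝 0) ∧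
          ∀ L ≥ L₀, AngularLadder.RungIsSingular L →
            ∃ (c : ℝ) (R : EuclideanSpace ℝ (Fin 3) ≃ₗᵢ[ℝ] EuclideanSpace ℝ (Fin 3))
              (u : ℝ → EuclideanSpace ℝ (Fin 3) → EuclideanSpace ℝ (Fin 3))
              (p : ℝ → EuclideanSpace ℝ (Fin 3) → ℝ)
              (d : ℝ → EuclideanSpace ℝ (Fin 3) → EuclideanSpace ℝ (Fin 3)),
              AngularLadder.IsWindowProfile L C₀ cmin cmax δ (ε L) c R u p d ∧
              ((∀ t < 0, IsAxisymmetric (u t)) ∨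
                (∃ q : ℕ, 0 < q ∧ q ≤ Q ∧ cmax ^ q < κ ∧ R ^ q = 1) ∨
                (∃ (q : ℕ) (g : EuclideanSpace ℝ (Fin 3) ≃ₗᵢ[ℝ] EuclideanSpace ℝ (Fin 3)) (θ : ℝ),
                  0 < q ∧ q ≤ Q ∧ cmax ^ q < c₁ ∧ (∀ x, (R ^ q) x = g (rotZ θ (g.symm x))) ∧
                  |θ| ≤ 2 * α₁ * (q * Real.log c)) ∨
                (∃ (g : EuclideanSpace ℝ (Fin 3) ≃ₗᵢ[ℝ] EuclideanSpace ℝ (Fin 3)) (θ : ℝ),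
                  (∀ x, R x = g (rotZ θ (g.symm x))) ∧ |θ| ≤ Θ ∧ 2 * α₂ * Real.log c ≤ |θ| ∧
                  (1 + (θ / (2 * Real.log c)) ^ 2) * Real.log c ≤ ℓ))) := by
  obtain ⟨κ, α₁, c₁, α₂, c₂, hκ, hα₁, hc₁, hα₂, hc₂, H⟩ := no_windowSequence_mixedStrata C₀
  refine ⟨κ, α₁, c₁, α₂, c₂, hκ, hα₁, hc₁, hα₂, hc₂, fun Q Θ ℓ hℓ => ?_⟩
  rintro ⟨h₁, cmin, cmax, δ, L₀, ε, hcmin, hδ, hε, hwin⟩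
  choose L hLge hLsing using fun n : ℕ => h₁ (max L₀ n)
  choose c R u p d hW hS using fun n : ℕ =>
    hwin (L n) (le_trans (le_max_left _ _) (hLge n)) (hLsing n)
  have hε' : Tendsto (fun n : ℕ => ε (L n)) atTop (𝓝 0) :=
    hε.comp (tendsto_atTop_mono (fun n => le_trans (le_max_right _ _) (hLge n)) tendsto_id)
  exact H Q Θ ℓ hℓ hcmin hδ hε' hW hS

/-- Census edge on K1: a `NoOverheating` met window-by-window inside the excluded strata (mixing
allowed, powers `≤ Q`, fast-screw bounds `Θ`, `ℓ < log c₂(C₀)`) refutes `RungBlowupCofinal`.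
[cite: ChaeWolf2017RemovingDSS, Theorem 1.3] [cite: PineauVicol2026, Theorem 1.7 (i)–(ii)] -/
theorem rungBlowupCofinal_false_of_noOverheating_mixedStrata (C₀ : ℝ) :
    ∃ κ α₁ c₁ α₂ c₂ : ℝ, 1 < κ ∧ 0 < α₁ ∧ 1 < c₁ ∧ 0 < α₂ ∧ 1 < c₂ ∧
      ∀ (Q : ℕ) (Θ ℓ : ℝ) {cmin cmax δ : ℝ} {L₀ : ℕ} {ε : ℕ → ℝ}, ℓ < Real.log c₂ →
        1 < cmin → 0 < δ → Tendsto ε atTop (𝓝 0) →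
        (∀ L ≥ L₀, AngularLadder.RungIsSingular L →
          ∃ (c : ℝ) (R : EuclideanSpace ℝ (Fin 3) ≃ₗᵢ[ℝ] EuclideanSpace ℝ (Fin 3))
            (u : ℝ → EuclideanSpace ℝ (Fin 3) → EuclideanSpace ℝ (Fin 3))
            (p : ℝ → EuclideanSpace ℝ (Fin 3) → ℝ)
            (d : ℝ → EuclideanSpace ℝ (Fin 3) → EuclideanSpace ℝ (Fin 3)),
            AngularLadder.IsWindowProfile L C₀ cmin cmax δ (ε L) c R u p d ∧
            ((∀ t < 0, IsAxisymmetric (u t)) ∨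
              (∃ q : ℕ, 0 < q ∧ q ≤ Q ∧ cmax ^ q < κ ∧ R ^ q = 1) ∨
              (∃ (q : ℕ) (g : EuclideanSpace ℝ (Fin 3) ≃ₗᵢ[ℝ] EuclideanSpace ℝ (Fin 3)) (θ : ℝ),
                0 < q ∧ q ≤ Q ∧ cmax ^ q < c₁ ∧ (∀ x, (R ^ q) x = g (rotZ θ (g.symm x))) ∧
                |θ| ≤ 2 * α₁ * (q * Real.log c)) ∨
              (∃ (g : EuclideanSpace ℝ (Fin 3) ≃ₗᵢ[ℝ] EuclideanSpace ℝ (Fin 3)) (θ : ℝ),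
                (∀ x, R x = g (rotZ θ (g.symm x))) ∧ |θ| ≤ Θ ∧ 2 * α₂ * Real.log c ≤ |θ| ∧
                (1 + (θ / (2 * Real.log c)) ^ 2) * Real.log c ≤ ℓ))) →
        ¬ RungBlowupCofinal := by
  obtain ⟨κ, α₁, c₁, α₂, c₂, hκ, hα₁, hc₁, hα₂, hc₂, H⟩ :=
    not_cofinal_and_noOverheating_mixedStrata C₀
  exact ⟨κ, α₁, c₁, α₂, c₂, hκ, hα₁, hc₁, hα₂, hc₂,
    fun Q Θ ℓ {cmin cmax δ L₀ ε} hℓ hcmin hδ hε hwin h₁ =>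
      H Q Θ ℓ hℓ ⟨h₁, cmin, cmax, δ, L₀, ε, hcmin, hδ, hε, hwin⟩⟩

end Summit.NavierStokesRegularity.AngularGalerkinLadderMixedStrataExcluded
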